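import Summits.Parity.BatemanHorn.Theorems.SoloInformedPowerValues
import Mathlib.Analysis.SpecialFunctions.Pow.Asymptotics

/-!
# SoloInformedPowerValuesCount — `d`-th power values of a degree-`d` irreducible polynomial are `o(x / log x)`

Solo unit `solo-Parity-informed` (ideation tier, informed mode), session 14; `PLAN.md` §22.5(b), CLAIMS C60.

`eventually_card_powValues_mul_log_le`: for `g ∈ ℤ[X]` irreducible of degree `d ≥ 2` with positive leading
coefficient and every `δ > 0`, eventually `#{1 ≤ n ≤ x : |g(n)| = m^d for some m} · log x ≤ δ x`.
Proof: by `SoloInformedPowerValues`, either the set of such `n` is finite (leading coefficient a `d`-th power), or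
the solutions `n ≥ √x` are `≥ (√x/K)^{1/(d-1)}` apart (Liouville spacing), whence their number is
`≤ n₁ + √x + 1 + x (K/√x)^{1/(d-1)} = o(x/log x)`.  This is the exponent `k = d` of hypothesis `hPP` of
`SoloInformedPolynomialPrimeCount`.
-/

namespace Summit.Parity.BatemanHorn.Theorems

open Finset Filter Polynomial Asymptotics
open scoped Topology

/-- A subset of `[N₀, x]` whose elements are pairwise `≥ L` apart has at most `(x - N₀)/L + 1` elements. -/
theorem card_le_of_spacing {T : Finset ℕ} {N₀ x : ℕ} (hT : T ⊆ Icc N₀ x) (hx : N₀ ≤ x) {L : ℝ}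
    (hL : 0 < L)
    (hsep : ∀ n ∈ T, ∀ n' ∈ T, n < n' → L ≤ (n' : ℝ) - n) :
    (#T : ℝ) ≤ ((x : ℝ) - N₀) / L + 1 := by
  have hx' : (0 : ℝ) ≤ (x : ℝ) - N₀ := by
    have : (N₀ : ℝ) ≤ x := by exact_mod_cast hx
    linarith
  set φ : ℕ → ℕ := fun n => ⌊((n : ℝ) - N₀) / L⌋₊ with hφ
  have hmaps : Set.MapsTo φ (T : Set ℕ) (range (⌊((x : ℝ) - N₀) / L⌋₊ + 1) : Set ℕ) := by
    intro n hn
    have hnx : n ≤ x := (mem_Icc.mp (hT hn)).2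
    rw [coe_range, Set.mem_Iio, Nat.lt_succ_iff, hφ]
    exact Nat.floor_le_floor (div_le_div_of_nonneg_right (by gcongr) hL.le)
  -- injectivity: a gap `≥ L` moves the floor by at least one
  have hlt : ∀ n ∈ T, ∀ n' ∈ T, n < n' → φ n < φ n' := by
    intro n hn n' hn' hnn'
    have hN₀n : (N₀ : ℝ) ≤ n := by exact_mod_cast (mem_Icc.mp (hT hn)).1
    have hu : 0 ≤ ((n : ℝ) - N₀) / L := div_nonneg (by linarith) hL.le
    have hstep : ((n : ℝ) - N₀) / L + 1 ≤ ((n' : ℝ) - N₀) / L := by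
      rw [div_add_one hL.ne', div_le_div_iff_of_pos_right hL]
      linarith [hsep n hn n' hn' hnn']
    simp only [hφ]
    calc ⌊((n : ℝ) - N₀) / L⌋₊ < ⌊((n : ℝ) - N₀) / L⌋₊ + 1 := Nat.lt_succ_self _
      _ = ⌊((n : ℝ) - N₀) / L + 1⌋₊ := (Nat.floor_add_one hu).symm
      _ ≤ ⌊((n' : ℝ) - N₀) / L⌋₊ := Nat.floor_le_floor hstep
  have hinj : Set.InjOn φ (T : Set ℕ) := by
    intro n hn n' hn' h
    rcases lt_trichotomy n n' with hlt' | heq | hgt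
    · exact absurd h (hlt n hn n' hn' hlt').ne
    · exact heq
    · exact absurd h (hlt n' hn' n hn hgt).ne'
  have hcard := card_le_card_of_injOn φ hmaps hinj
  rw [card_range] at hcard
  calc (#T : ℝ) ≤ ((⌊((x : ℝ) - N₀) / L⌋₊ + 1 : ℕ) : ℝ) := by exact_mod_cast hcard
    _ ≤ ((x : ℝ) - N₀) / L + 1 := by
        push_cast
        linarith [Nat.floor_le (div_nonneg hx' hL.le)]

open scoped Classical in
/-- **The `n ≤ x` at which `|g(n)|` is a `d`-th power are `o(x / log x)`** (`g` irreducible, `deg g = d ≥ 2`,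
positive leading coefficient). -/
theorem eventually_card_powValues_mul_log_le {g : ℤ[X]} (hirr : Irreducible g) (hdeg : 2 ≤ g.natDegree)
    (hlc : 0 < g.leadingCoeff) {δ : ℝ} (hδ : 0 < δ) :
    ∀ᶠ x : ℕ in atTop,
      (#((Icc 1 x).filter fun n : ℕ => ∃ m : ℕ, (g.eval (n : ℤ)).natAbs = m ^ g.natDegree) : ℝ)
        * Real.log x ≤ δ * x := by
  -- `log x ≤ c x^r` eventually (`r, c > 0`), proved inline
  have hlogr : ∀ {r c : ℝ}, 0 < r → 0 < c → ∀ᶠ x : ℕ in atTop, Real.log x ≤ c * (x : ℝ) ^ r := by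
    intro r c hr hc
    have h := ((isLittleO_log_rpow_atTop hr).comp_tendsto tendsto_natCast_atTop_atTop).def hc
    filter_upwards [h] with x hx
    simp only [Function.comp_apply, Real.norm_eq_abs] at hx
    rw [abs_of_nonneg (Real.rpow_nonneg (Nat.cast_nonneg x) r)] at hx
    exact (le_abs_self _).trans hx
  have hlog1 : ∀ {c : ℝ}, 0 < c → ∀ᶠ x : ℕ in atTop, Real.log x ≤ c * (x : ℝ) := by
    intro c hc
    filter_upwards [hlogr one_pos hc] with x hx
    rwa [Real.rpow_one] at hx
  by_cases hpow : ∃ A : ℕ, g.leadingCoeff = (A : ℤ) ^ g.natDegree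
  · -- leading coefficient a `d`-th power: finitely many solutions
    obtain ⟨A, hA⟩ := hpow
    obtain ⟨T, hT⟩ := exists_finset_of_leadingCoeff_eq_pow hirr hdeg hlc hA
    filter_upwards [hlog1 (show 0 < δ / (#T + 1) by positivity), eventually_ge_atTop 1]
      with x hx hx1
    have hlog : 0 ≤ Real.log x := Real.log_nonneg (by exact_mod_cast hx1)
    have hsub : (Icc 1 x).filter (fun n : ℕ => ∃ m : ℕ, (g.eval (n : ℤ)).natAbs = m ^ g.natDegree) ⊆ T := by
      intro n hn
      obtain ⟨m, hm⟩ := (mem_filter.mp hn).2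
      exact hT n m hm
    have hcard : (#((Icc 1 x).filter fun n : ℕ => ∃ m : ℕ, (g.eval (n : ℤ)).natAbs = m ^ g.natDegree) : ℝ)
        ≤ #T := by exact_mod_cast card_le_card hsub
    have hT1 : (#T : ℝ) / (#T + 1) ≤ 1 := by rw [div_le_one (by positivity)]; linarith
    have hx0 : (0 : ℝ) ≤ δ * x := by positivity
    calc _ ≤ (#T : ℝ) * Real.log x := mul_le_mul_of_nonneg_right hcard hlog
      _ ≤ (#T : ℝ) * (δ / (#T + 1) * x) := mul_le_mul_of_nonneg_left hx (Nat.cast_nonneg _)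
      _ = (#T / (#T + 1)) * (δ * x) := by ring
      _ ≤ 1 * (δ * x) := mul_le_mul_of_nonneg_right hT1 hx0
      _ = δ * x := one_mul _
  · -- leading coefficient not a `d`-th power: Liouville spacing
    push Not at hpow
    obtain ⟨n₁, hn₁1, K, hK0, hK⟩ := exists_spacing_of_leadingCoeff_ne_pow hdeg hlc hpow
    set d := g.natDegree with hd
    have hd1 : d - 1 ≠ 0 := by omega
    -- exponent `r = 1/(d-1)` and the three eventual inequalities
    set r : ℝ := ((d - 1 : ℕ) : ℝ)⁻¹ with hr
    have hr0 : 0 < r := by rw [hr]; positivity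
    have E1 := hlogr (show (0 : ℝ) < 1 / 2 by norm_num) (show 0 < δ / 4 by positivity)
    have E2 := hlog1 (show 0 < δ / 4 / (n₁ + 2) by positivity)
    have E3 := hlogr (show 0 < 1 / 2 * r by positivity)
      (show 0 < δ / 4 / K ^ r by positivity)
    filter_upwards [E1, E2, E3, eventually_ge_atTop (max n₁ 3)] with x hx1 hx2 hx3 hx
    have hxn₁ : n₁ ≤ x := (le_max_left _ _).trans hx
    have hx3' : 3 ≤ x := (le_max_right _ _).trans hx
    have hxpos : (0 : ℝ) < x := by exact_mod_cast (show 0 < x by omega)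
    have hlog : 0 ≤ Real.log x := Real.log_nonneg (by exact_mod_cast (show 1 ≤ x by omega))
    -- the threshold `N₀ = max n₁ (⌊√x⌋ + 1)`
    set N₀ : ℕ := max n₁ (⌊Real.sqrt x⌋₊ + 1) with hN₀
    have hN₀n₁ : n₁ ≤ N₀ := le_max_left _ _
    have hsqrt_le : Real.sqrt x ≤ N₀ := by
      have h1 : Real.sqrt x < (⌊Real.sqrt x⌋₊ : ℝ) + 1 := Nat.lt_floor_add_one _
      have h2 : ((⌊Real.sqrt x⌋₊ + 1 : ℕ) : ℝ) ≤ N₀ := by exact_mod_cast le_max_right _ _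
      push_cast at h2
      linarith
    have hN₀le : (N₀ : ℝ) ≤ n₁ + Real.sqrt x + 1 := by
      have h1 : N₀ ≤ n₁ + (⌊Real.sqrt x⌋₊ + 1) := max_le (Nat.le_add_right _ _) (Nat.le_add_left _ _)
      have h2 : (N₀ : ℝ) ≤ n₁ + (⌊Real.sqrt x⌋₊ + 1) := by exact_mod_cast h1
      have h3 : (⌊Real.sqrt x⌋₊ : ℝ) ≤ Real.sqrt x := Nat.floor_le (Real.sqrt_nonneg _)
      linarith
    have hN₀x : N₀ ≤ x := by
      refine max_le hxn₁ ?_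
      -- `⌊√x⌋ + 1 ≤ x` for `x ≥ 3`
      have hx3r : (3 : ℝ) ≤ x := by exact_mod_cast hx3'
      have hs : Real.sqrt x + 1 ≤ x := by
        have hs1 : Real.sqrt x ≤ (x : ℝ) / 2 + 1 / 2 := by
          rw [Real.sqrt_le_left (by positivity)]
          nlinarith
        nlinarith [Real.sq_sqrt hxpos.le, Real.sqrt_nonneg (x : ℝ)]
      have h1 : ((⌊Real.sqrt x⌋₊ + 1 : ℕ) : ℝ) ≤ x := by
        push_cast
        linarith [Nat.floor_le (Real.sqrt_nonneg (x : ℝ))]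
      exact_mod_cast h1
    have hN₀pos : (0 : ℝ) < N₀ := by
      have : (1 : ℝ) ≤ N₀ := by exact_mod_cast hn₁1.trans hN₀n₁
      linarith
    -- the spacing `L = (N₀/K)^{1/(d-1)}` of solutions `≥ N₀`
    set L : ℝ := ((N₀ : ℝ) / K) ^ r with hL
    have hL0 : 0 < L := Real.rpow_pos_of_pos (div_pos hN₀pos hK0) _
    have hLpow : L ^ (d - 1) = (N₀ : ℝ) / K := by
      rw [hL, hr, Real.rpow_inv_natCast_pow (div_pos hN₀pos hK0).le hd1]
    set S := (Icc 1 x).filter fun n : ℕ => ∃ m : ℕ, (g.eval (n : ℤ)).natAbs = m ^ g.natDegree with hS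
    set T := S.filter fun n : ℕ => N₀ ≤ n with hT
    have hTsub : T ⊆ Icc N₀ x := by
      intro n hn
      rw [hT, mem_filter, hS, mem_filter, mem_Icc] at hn
      exact mem_Icc.mpr ⟨hn.2, hn.1.1.2⟩
    have hsep : ∀ n ∈ T, ∀ n' ∈ T, n < n' → L ≤ (n' : ℝ) - n := by
      intro n hn n' hn' hnn'
      rw [hT, mem_filter, hS, mem_filter] at hn hn'
      obtain ⟨⟨-, m, hm⟩, hnN₀⟩ := hn
      obtain ⟨⟨-, m', hm'⟩, -⟩ := hn'
      have hsp := hK n n' (hN₀n₁.trans hnN₀) hnn' m m' hm hm'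
      -- `(n'-n)^{d-1} ≥ n/K ≥ N₀/K = L^{d-1}`
      have hnn'0 : (0 : ℝ) ≤ (n' : ℝ) - n := by
        have : (n : ℝ) ≤ n' := by exact_mod_cast hnn'.le
        linarith
      have h1 : L ^ (d - 1) ≤ ((n' : ℝ) - n) ^ (d - 1) := by
        rw [hLpow, div_le_iff₀ hK0]
        calc (N₀ : ℝ) ≤ n := by exact_mod_cast hnN₀
          _ ≤ K * ((n' : ℝ) - n) ^ (d - 1) := hsp
          _ = ((n' : ℝ) - n) ^ (d - 1) * K := mul_comm _ _
      exact (pow_le_pow_iff_left₀ hL0.le hnn'0 hd1).mp h1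
    have hTcard := card_le_of_spacing hTsub hN₀x hL0 hsep
    -- `#S ≤ N₀ + #T`
    have hScard : (#S : ℝ) ≤ N₀ + ((x : ℝ) - N₀) / L + 1 := by
      have hsplit := card_filter_add_card_filter_not (s := S) (fun n : ℕ => N₀ ≤ n)
      have hsmall : #(S.filter fun n : ℕ => ¬N₀ ≤ n) ≤ N₀ := by
        calc #(S.filter fun n : ℕ => ¬N₀ ≤ n) ≤ #(range N₀) := by
              refine card_le_card fun n hn => ?_
              rw [mem_filter] at hn
              exact mem_range.mpr (by omega)
          _ = N₀ := card_range _
      have h1 : (#S : ℝ) = #T + #(S.filter fun n : ℕ => ¬N₀ ≤ n) := by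
        rw [hT]; exact_mod_cast hsplit.symm
      have h2 : (#(S.filter fun n : ℕ => ¬N₀ ≤ n) : ℝ) ≤ N₀ := by exact_mod_cast hsmall
      linarith
    -- `x / L ≤ x (K/√x)^r`, and the three pieces are each `≤ δ x / 4` after multiplying by `log x`
    have hxL : ((x : ℝ) - N₀) / L ≤ (x : ℝ) / L :=
      div_le_div_of_nonneg_right (by linarith [hN₀pos]) hL0.le
    have hLlb : (Real.sqrt x / K) ^ r ≤ L := by
      rw [hL]
      exact Real.rpow_le_rpow (by positivity) (div_le_div_of_nonneg_right hsqrt_le hK0.le) hr0.le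
    have hsqrtK : (Real.sqrt x / K) ^ r = (x : ℝ) ^ (1 / 2 * r) / K ^ r := by
      rw [Real.div_rpow (Real.sqrt_nonneg _) hK0.le, Real.sqrt_eq_rpow, ← Real.rpow_mul hxpos.le]
    -- piece 1: `√x log x ≤ δ x / 4`
    have P1 : Real.sqrt x * Real.log x ≤ δ / 4 * x := by
      have h1 : Real.log x ≤ δ / 4 * Real.sqrt x := by rw [Real.sqrt_eq_rpow]; exact hx1
      calc Real.sqrt x * Real.log x ≤ Real.sqrt x * (δ / 4 * Real.sqrt x) :=
            mul_le_mul_of_nonneg_left h1 (Real.sqrt_nonneg _)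
        _ = δ / 4 * (Real.sqrt x * Real.sqrt x) := by ring
        _ = δ / 4 * x := by rw [Real.mul_self_sqrt hxpos.le]
    -- piece 2: `(n₁ + 2) log x ≤ δ x / 4`
    have P2 : ((n₁ : ℝ) + 2) * Real.log x ≤ δ / 4 * x := by
      have h1 := mul_le_mul_of_nonneg_left hx2 (show (0 : ℝ) ≤ n₁ + 2 by positivity)
      calc ((n₁ : ℝ) + 2) * Real.log x ≤ ((n₁ : ℝ) + 2) * (δ / 4 / (n₁ + 2) * x) := h1
        _ = δ / 4 * x := by field_simp
    -- piece 3: `(x / L) log x ≤ δ x / 4`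
    have P3 : (x : ℝ) / L * Real.log x ≤ δ / 4 * x := by
      have h1 : Real.log x ≤ δ / 4 * L := by
        calc Real.log x ≤ δ / 4 / K ^ r * (x : ℝ) ^ (1 / 2 * r) := hx3
          _ = δ / 4 * ((Real.sqrt x / K) ^ r) := by rw [hsqrtK]; ring
          _ ≤ δ / 4 * L := mul_le_mul_of_nonneg_left hLlb (by positivity)
      calc (x : ℝ) / L * Real.log x ≤ (x : ℝ) / L * (δ / 4 * L) :=
            mul_le_mul_of_nonneg_left h1 (by positivity)
        _ = δ / 4 * x := by field_simp
    -- assemble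
    calc (#S : ℝ) * Real.log x ≤ ((N₀ : ℝ) + ((x : ℝ) - N₀) / L + 1) * Real.log x :=
          mul_le_mul_of_nonneg_right hScard hlog
      _ ≤ (((n₁ : ℝ) + 2) + Real.sqrt x + (x : ℝ) / L) * Real.log x := by
          apply mul_le_mul_of_nonneg_right _ hlog
          linarith [hxL, hN₀le]
      _ = ((n₁ : ℝ) + 2) * Real.log x + Real.sqrt x * Real.log x + (x : ℝ) / L * Real.log x := by ring
      _ ≤ δ / 4 * x + δ / 4 * x + δ / 4 * x := add_le_add (add_le_add P2 P1) P3
      _ ≤ δ * x := by nlinarith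

end Summit.Parity.BatemanHorn.Theorems
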